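import Summits.NavierStokesRegularity.NavierStokesRegularity.Theses.GaldiLiouvilleGate

/-!
# Route GaldiLiouvilleGate — `Assembly` (item stmt-NavierStokesRegularity-0892)

Pure logic: the route statements of `GaldiLiouvilleGate`, in the antecedent order

  `ParabolicGaldiLiouville → RecordZoomAncient → NoBlowupToClay → NavierStokesRegularity`,

imply Clay (A). This is, hypothesis for hypothesis, the route's deciding theorem
`Summit.NavierStokesRegularity.NavierStokesRegularity.Theses.GaldiLiouvilleGate.closes`; the proof
below is self-contained (it does not invoke `closes`), so that it depends only on the item
definition.

Argument. `NoBlowupToClay` reduces `NavierStokesRegularity` to: every finite-energy (Leray–Hopf)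
classical solution on `ℝ³ × [0,T)` from a rapidly decaying datum extends smoothly past `T`. Suppose
one does not. Then `RecordZoomAncient` (Z) produces a bounded ancient mild solution `v` (ν = 1),
smooth, with `∫⁻ |∇v(s)|² ≤ 1` for all `s < 0`, `v(s) ∈ L⁶`, and `v ≢ 0`; `ParabolicGaldiLiouville`
(X2), applied with the enstrophy bound `C = 1`, forces `v ≡ 0`: contradiction. Nothing here is new
mathematics; the open content lives in the cruxes X2 and Z.
-/

namespace Summit.NavierStokesRegularity.NavierStokesRegularity.Theorems

open Summit.NavierStokesRegularity.NavierStokesRegularity.Theses.GaldiLiouvilleGate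

/-- **Assembly** (item stmt-NavierStokesRegularity-0892, route GaldiLiouvilleGate):
`ParabolicGaldiLiouville → RecordZoomAncient → NoBlowupToClay → NavierStokesRegularity` — pure
logic: `NoBlowupToClay` reduces Clay (A) to continuation past every `T`; for a non-extendable
solution the record zoom `RecordZoomAncient` yields a nontrivial smooth bounded ancient mild
solution with enstrophy `≤ 1` and `L⁶` slices, which `ParabolicGaldiLiouville` (with `C = 1`)
forces to vanish identically — contradiction. [folklore] -/
theorem galdiLiouvilleGate_assembly_proof :
    Summit.NavierStokesRegularity.NavierStokesRegularity.Theses.GaldiLiouvilleGate.Assembly := by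
  unfold Assembly
  intro hX2 hZ hClay
  refine hClay ?_
  intro ν T hν hT u p hcl hLH hdec
  by_contra hext
  obtain ⟨v, hv, hsm, hens, hL6, hne⟩ := hZ ν T hν hT u p hcl hLH hdec hext
  exact hne (hX2 v hv hsm ⟨1, fun s hs => le_of_le_of_eq (hens s hs) ENNReal.coe_one.symm⟩ hL6)

end Summit.NavierStokesRegularity.NavierStokesRegularity.Theorems
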